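import Literature.MathematicalPhysics.QuantumLattice.SchwartzPartition
import Literature.MathematicalPhysics.QuantumLattice.SchwingerOSAxioms
import HarnessLib

/-!
# A nuclear expansion of the Schwartz space of a finite-dimensional space

Trunk **T-AQFT** (topic `MathematicalPhysics/QuantumLattice`), families `constructive-qft`,
`crit-ising`; first support file of the discharge of the named fact
`Literature.MathematicalPhysics.QuantumLattice.SchwingerFamily.HasProductGrowth.hasLinearGrowth`
(`SchwingerGrowth`; Osterwalder–Schrader II, Appendix by S. Summers: the growth condition E0''
implies E0'). Summers expands a tempered distribution in Hermite functions; Mathlib has no Hermite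
functions, and we replace the Hermite expansion by the following elementary *nuclear expansion of
the identity* of `𝓢(E, ℂ)` (`E` finite-dimensional, linear coordinates `Λ : E ≃ ℝᵐ`), assembled
from the tree's lattice partition of unity (`SchwartzPartition`) and Fourier series in boxes
(`SchwartzFourierDensity`):

* `NuclearExpansion.eta Λ β` (`β ∈ ℤᵐ`): multiplication by the partition function `η_β`,
  `∑_{β ∈ [-R,R]ᵐ} η_β ψ → ψ` in `𝓢(E, ℂ)` (`tendsto_sum_eta`);
* `NuclearExpansion.e Λ β k` (`k ∈ ℤᵐ`): the elementary functions `P_β · e_k`, `P_β` a fixed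
  window translated to the lattice point `Λ⁻¹β` and `e_k` the characters of the period box
  `{|Λ(y)_c - β_c| ≤ 2}`; `NuclearExpansion.coeff Λ β k`: the continuous linear functionals
  `ψ ↦ c_k(η_β ψ)` (box Fourier coefficients), with
  `η_β ψ = ∑_k c_k(η_β ψ) · (P_β e_k)` unconditionally in `𝓢(E, ℂ)` (`hasSum_coeff_smul_e`).

The quantitative half (decay of the coefficients against the growth of the Schwartz norms of the
elementary functions, i.e. `∑_{β,k} ‖coeff_{β,k}‖_{(t)} |e_{β,k}|_s < ∞`) is in the companion file
`SchwartzNuclearExpansionBounds`. Together they say that the identity of `𝓢(E, ℂ)` is a nuclear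
map in Grothendieck's sense, which is the property of `𝒮` that Summers' Hermite argument uses.

## Sources

* K. Osterwalder, R. Schrader, *Axioms for Euclidean Green's functions II*, Comm. Math. Phys.
  42 (1975) 281–305, Appendix (S. Summers), pp. 303–305 — the consumer. [OsterwalderSchraderCMP1975]
* The localisation-plus-Fourier-series expansion is textbook folklore (the elementary proofs of
  the nuclearity of `𝒮` and of the kernel theorem); the proofs are self-contained on top of the
  tree (`SchwartzPartition`, `SchwartzFourierDensity`).

## Mathlib and Literature

Used from Mathlib: `SchwartzMap.smulLeftCLM` (`_sum`), `SchwartzMap.compSubConstCLM`,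
`SchwartzMap.compCLMOfContinuousLinearEquiv`, `SchwartzMap.fourierTransformCLM`,
`SchwartzMap.toBoundedContinuousFunctionCLM`, `BoundedContinuousFunction.evalCLM`,
`HasCompactSupport.toSchwartzMap`, `ContinuousLinearEquiv.equivOfInverse`. From the tree:
`latticeBump`, `latticeWindow`, `latticeCube`, `tendsto_latticeWindow_smul`, `pouWindow`
(`SchwartzPartition`); `intVec`, `eChar`, `toCube`, `boxCoeff`, `tendsto_sum_boxCoeff_smul`
(`SchwartzFourierDensity`). Searched and absent at the pin (Mathlib): Hermite functions as
Schwartz functions, any Schauder-type expansion of `SchwartzMap`.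
-/

open scoped SchwartzMap Real FourierTransform Topology ContDiff
open Filter Set

noncomputable section

namespace Literature.MathematicalPhysics.QuantumLattice

namespace NuclearExpansion

/-! ### Point evaluations -/

section Delta

variable {V : Type*} [NormedAddCommGroup V] [NormedSpace ℝ V]

/-- Evaluation of a complex test function at a point, as a continuous linear functional
`δ_x : 𝓢(V, ℂ) → ℂ` (through the bounded continuous functions). [folklore] -/
def delta (x : V) : 𝓢(V, ℂ) →L[ℂ] ℂ :=
  (BoundedContinuousFunction.evalCLM ℂ x).comp (SchwartzMap.toBoundedContinuousFunctionCLM ℂ V ℂ)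

/-- `delta x f = f x`. [folklore] -/
@[simp]
theorem delta_apply (x : V) (f : 𝓢(V, ℂ)) : delta x f = f x := rfl

end Delta

/-! ### One-dimensional windows vanish far out -/

/-- The window `w_R` vanishes outside `(-R-1, R+1)`: `w_R(t) = 0` for `R + 1 ≤ |t|` (`R ≥ 0`).
(The same statement is proved as `Literature.Barriers.QuantumFields.pouWindow_eq_zero` in the
barrier file `GoldstoneTheoremProofs`; it is restated here, next to its natural home
`SchwartzPartition`, so as not to import the Goldstone barrier development.) [folklore] -/
theorem pouWindow_eq_zero {R t : ℝ} (hR : 0 ≤ R) (ht : R + 1 ≤ |t|) : pouWindow R t = 0 := by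
  unfold pouWindow
  rcases le_abs'.1 ht with h | h
  · rw [Real.smoothTransition.zero_of_nonpos (by linarith),
      Real.smoothTransition.zero_of_nonpos (by linarith), sub_self]
  · rw [Real.smoothTransition.one_of_one_le (by linarith),
      Real.smoothTransition.one_of_one_le (by linarith), sub_self]

/-! ### Coordinates: lattice points, cube coordinates of the period boxes -/

section Coordinates

variable {E : Type*} [NormedAddCommGroup E] [NormedSpace ℝ E] {m : ℕ}
  (Λ : E ≃L[ℝ] EuclideanSpace ℝ (Fin m))

/-- The lattice point `Λ⁻¹ β ∈ E` of `β ∈ ℤᵐ`. [folklore] -/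
def latVec (β : Fin m → ℤ) : E := Λ.symm (intVec β)

/-- The coordinates of a lattice point: `Λ(Λ⁻¹β)_c = β_c`. [folklore] -/
@[simp]
theorem coord_latVec (β : Fin m → ℤ) (c : Fin m) : (Λ (latVec Λ β)) c = β c := by
  simp [latVec]

/-- The cube coordinates `y ↦ Λ(y) / 4`, a continuous linear equivalence `E ≃ ℝᵐ` sending the
period box `{|Λ(y)_c - β_c| ≤ 2}` onto a translate of the unit cube. [folklore] -/
def cubeCoord : E ≃L[ℝ] EuclideanSpace ℝ (Fin m) :=
  ContinuousLinearEquiv.equivOfInverse ((4 : ℝ)⁻¹ • (Λ : E →L[ℝ] EuclideanSpace ℝ (Fin m)))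
    ((4 : ℝ) • (Λ.symm : EuclideanSpace ℝ (Fin m) →L[ℝ] E))
    (fun x => by simp [smul_smul])
    (fun y => by simp [smul_smul])

/-- `cubeCoord Λ y = Λ y / 4`. [folklore] -/
@[simp]
theorem cubeCoord_apply (y : E) : cubeCoord Λ y = (4 : ℝ)⁻¹ • Λ y := rfl

/-- The shift of the cube coordinates of the box at `β`: `w_β = (2 - β) / 4`. [folklore] -/
def cubeShift (β : Fin m → ℤ) : EuclideanSpace ℝ (Fin m) :=
  WithLp.toLp 2 fun c => (2 - (β c : ℝ)) / 4

/-- Coordinates of the shift. [folklore] -/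
@[simp]
theorem cubeShift_apply (β : Fin m → ℤ) (c : Fin m) : cubeShift β c = (2 - (β c : ℝ)) / 4 := rfl

/-- The affine cube coordinates of the box at `β`: `(Λ(y)_c - β_c + 2) / 4`. [folklore] -/
theorem cubeCoord_add_cubeShift_apply (β : Fin m → ℤ) (y : E) (c : Fin m) :
    (cubeCoord Λ y + cubeShift β) c = ((Λ y) c - β c + 2) / 4 := by
  simp only [PiLp.add_apply, cubeCoord_apply, PiLp.smul_apply, smul_eq_mul, cubeShift_apply]
  ring

/-- The affine cube coordinates of the box at `β` are those of the box at `0` after translating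
by the lattice point. [folklore] -/
theorem cubeCoord_sub_latVec_add_cubeShift (β : Fin m → ℤ) (y : E) :
    cubeCoord Λ (y - latVec Λ β) + cubeShift 0 = cubeCoord Λ y + cubeShift β := by
  ext c
  rw [cubeCoord_add_cubeShift_apply, cubeCoord_add_cubeShift_apply]
  simp only [map_sub, PiLp.sub_apply, coord_latVec, Pi.zero_apply, Int.cast_zero, sub_zero]

end Coordinates

/-! ### The partition operators `η_β` -/

section Eta

variable {E : Type*} [NormedAddCommGroup E] [NormedSpace ℝ E] [FiniteDimensional ℝ E] {m : ℕ}
  (Λ : E ≃L[ℝ] EuclideanSpace ℝ (Fin m))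

/-- The partition function `η_β` as a complex-valued function. [folklore] -/
def etaFun (β : Fin m → ℤ) : E → ℂ := fun y => ((latticeBump Λ β y : ℝ) : ℂ)

omit [FiniteDimensional ℝ E] in
/-- `η_β` is smooth. [folklore] -/
theorem contDiff_etaFun (β : Fin m → ℤ) : ContDiff ℝ ∞ (etaFun Λ β) :=
  contDiff_ofReal_comp ℂ (contDiff_latticeBump Λ β)

/-- `η_β` has compact support. [folklore] -/
theorem hasCompactSupport_etaFun (β : Fin m → ℤ) : HasCompactSupport (etaFun Λ β) :=
  (hasCompactSupport_latticeBump Λ β).comp_left Complex.ofReal_zero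

/-- `η_β` has temperate growth. [folklore] -/
theorem hasTemperateGrowth_etaFun (β : Fin m → ℤ) : (etaFun Λ β).HasTemperateGrowth :=
  (hasCompactSupport_etaFun Λ β).hasTemperateGrowth (contDiff_etaFun Λ β)

/-- The partition operator `ψ ↦ η_β ψ` on `𝓢(E, ℂ)`. [folklore] -/
def eta (β : Fin m → ℤ) : 𝓢(E, ℂ) →L[ℂ] 𝓢(E, ℂ) := SchwartzMap.smulLeftCLM ℂ (etaFun Λ β)

/-- `η_β ψ (y) = η_β(y) ψ(y)`. [folklore] -/
@[simp]
theorem eta_apply (β : Fin m → ℤ) (ψ : 𝓢(E, ℂ)) (y : E) :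
    eta Λ β ψ y = ((latticeBump Λ β y : ℝ) : ℂ) * ψ y := by
  rw [eta, SchwartzMap.smulLeftCLM_apply_apply (hasTemperateGrowth_etaFun Λ β), smul_eq_mul]
  rfl

/-- `η_β ψ` is supported in the support of `η_β`, i.e. in `{|Λ(y)_c - β_c| ≤ 1}`. [folklore] -/
theorem tsupport_eta_subset (β : Fin m → ℤ) (ψ : 𝓢(E, ℂ)) :
    tsupport (eta Λ β ψ : E → ℂ) ⊆ {y | ∀ c, (Λ y) c - β c ∈ Icc (-1 : ℝ) 1} := by
  refine Subset.trans ?_ (tsupport_latticeBump_subset Λ β)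
  refine closure_mono fun y hy => ?_
  rw [Function.mem_support] at hy ⊢
  intro h0
  exact hy (by rw [eta_apply, h0, Complex.ofReal_zero, zero_mul])

/-- `η_β ψ` is a translate: `η_β ψ = (η₀ · ψ(· + Λ⁻¹β))(· - Λ⁻¹β)`. [folklore] -/
theorem eta_eq_translate (β : Fin m → ℤ) (ψ : 𝓢(E, ℂ)) :
    eta Λ β ψ = SchwartzMap.compSubConstCLM ℂ (latVec Λ β)
      (eta Λ 0 (SchwartzMap.compSubConstCLM ℂ (-latVec Λ β) ψ)) := by
  ext y
  rw [SchwartzMap.compSubConstCLM_apply, eta_apply, eta_apply, SchwartzMap.compSubConstCLM_apply,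
    sub_neg_eq_add, sub_add_cancel, latticeBump_eq_comp_sub Λ β y]
  rfl

/-- **The partition of unity converges on `𝓢(E, ℂ)`**: `∑_{β ∈ [-R,R]ᵐ} η_β ψ → ψ` as `R → ∞`
(`tendsto_latticeWindow_smul`). [folklore] -/
theorem tendsto_sum_eta (ψ : 𝓢(E, ℂ)) :
    Tendsto (fun R : ℕ => ∑ β ∈ latticeCube m R, eta Λ β ψ) atTop (𝓝 ψ) := by
  have h : ∀ R : ℕ, ∑ β ∈ latticeCube m R, eta Λ β ψ =
      SchwartzMap.smulLeftCLM ℂ (fun y => ((latticeWindow Λ R y : ℝ) : ℂ)) ψ := by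
    intro R
    have hsum : (fun y => ((latticeWindow Λ R y : ℝ) : ℂ)) = fun y => ∑ β ∈ latticeCube m R, etaFun Λ β y := by
      funext y
      rw [← sum_latticeCube_latticeBump Λ R y, Complex.ofReal_sum]
      rfl
    rw [hsum, SchwartzMap.smulLeftCLM_sum fun β _ => hasTemperateGrowth_etaFun Λ β,
      FunLike.coe_sum, Finset.sum_apply]
    rfl
  simp_rw [h]
  exact tendsto_latticeWindow_smul Λ ℂ ψ

end Eta

/-! ### Windows and the elementary functions `P_β e_k` -/

section Elementary

variable {E : Type*} [NormedAddCommGroup E] [NormedSpace ℝ E] [FiniteDimensional ℝ E] {m : ℕ}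
  (Λ : E ≃L[ℝ] EuclideanSpace ℝ (Fin m))

/-- The window `P₀(y) = ∏_c w₁(Λ(y)_c)`, equal to `1` on `{|Λ(y)_c| ≤ 1}` and supported in
`{|Λ(y)_c| ≤ 2}`, as a complex-valued function. [folklore] -/
def winFun : E → ℂ := fun y => ((latticeWindow Λ 1 y : ℝ) : ℂ)

omit [FiniteDimensional ℝ E] in
/-- `P₀ = 1` on `{|Λ(y)_c| ≤ 1}`. [folklore] -/
theorem winFun_eq_one {y : E} (h : ∀ c, |(Λ y) c| ≤ 1) : winFun Λ y = 1 := by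
  unfold winFun latticeWindow
  rw [Finset.prod_eq_one fun c _ => pouWindow_eq_one (R := ((1 : ℕ) : ℝ)) (by rw [Nat.cast_one]; exact h c)]
  simp

omit [FiniteDimensional ℝ E] in
/-- `P₀ = 0` off `{|Λ(y)_c| < 2}`. [folklore] -/
theorem winFun_eq_zero {y : E} (h : ∃ c, 2 ≤ |(Λ y) c|) : winFun Λ y = 0 := by
  obtain ⟨c, hc⟩ := h
  unfold winFun latticeWindow
  rw [Finset.prod_eq_zero (Finset.mem_univ c) (pouWindow_eq_zero (R := ((1 : ℕ) : ℝ)) (by norm_num)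
    (by rw [Nat.cast_one]; linarith))]
  simp

omit [FiniteDimensional ℝ E] in
/-- `P₀` is smooth. [folklore] -/
theorem contDiff_winFun : ContDiff ℝ ∞ (winFun Λ) :=
  contDiff_ofReal_comp ℂ (contDiff_latticeWindow Λ 1)

omit [FiniteDimensional ℝ E] in
/-- The closed box `{|Λ(y)_c| ≤ M}` is bounded. [folklore] -/
theorem norm_le_of_abs_coord_le {M : ℝ} (hM : 0 ≤ M) {y : E} (h : ∀ c, |(Λ y) c| ≤ M) :
    ‖y‖ ≤ ‖(Λ.symm : EuclideanSpace ℝ (Fin m) →L[ℝ] E)‖ * (√m * M) := by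
  have hz : ‖Λ y‖ ≤ √m * M := by
    simpa using EuclideanSpace.norm_le_sqrt_card_mul (Λ y) hM h
  calc ‖y‖ = ‖Λ.symm (Λ y)‖ := by rw [ContinuousLinearEquiv.symm_apply_apply]
    _ ≤ ‖(Λ.symm : EuclideanSpace ℝ (Fin m) →L[ℝ] E)‖ * ‖Λ y‖ :=
        Λ.symm.toContinuousLinearMap.le_opNorm _
    _ ≤ _ := by gcongr

/-- The closed box `{|Λ(y)_c| ≤ M}` is compact. [folklore] -/
theorem isCompact_box (M : ℝ) : IsCompact {y : E | ∀ c, |(Λ y) c| ≤ M} := by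
  have hcl : IsClosed {y : E | ∀ c, |(Λ y) c| ≤ M} := by
    simp only [setOf_forall]
    refine isClosed_iInter fun c => ?_
    exact isClosed_le (continuous_abs.comp ((EuclideanSpace.proj c).continuous.comp Λ.continuous))
      continuous_const
  refine (isCompact_closedBall (0 : E)
    (‖(Λ.symm : EuclideanSpace ℝ (Fin m) →L[ℝ] E)‖ * (√m * max M 0))).of_isClosed_subset hcl ?_
  intro y hy
  rw [mem_closedBall_zero_iff]
  exact norm_le_of_abs_coord_le Λ (le_max_right _ _) fun c => (hy c).trans (le_max_left _ _)

/-- `P₀` has compact support (inside `{|Λ(y)_c| ≤ 2}`). [folklore] -/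
theorem hasCompactSupport_winFun : HasCompactSupport (winFun Λ) := by
  refine HasCompactSupport.intro (isCompact_box Λ 2) fun y hy => winFun_eq_zero Λ ?_
  simp only [Set.mem_setOf_eq, not_forall, not_le] at hy
  obtain ⟨c, hc⟩ := hy
  exact ⟨c, hc.le⟩

/-- The window `P₀` as a complex test function. [folklore] -/
def win : 𝓢(E, ℂ) := (hasCompactSupport_winFun Λ).toSchwartzMap (contDiff_winFun Λ)

/-- Evaluation of `win`. [folklore] -/
@[simp]
theorem win_apply (y : E) : win Λ y = winFun Λ y := rfl

/-- The translated windows `P_β = P₀(· - Λ⁻¹β)`. [folklore] -/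
def winAt (β : Fin m → ℤ) : 𝓢(E, ℂ) := SchwartzMap.compSubConstCLM ℂ (latVec Λ β) (win Λ)

/-- Evaluation of `winAt`. [folklore] -/
@[simp]
theorem winAt_apply (β : Fin m → ℤ) (y : E) : winAt Λ β y = winFun Λ (y - latVec Λ β) := rfl

omit [FiniteDimensional ℝ E] in
/-- Coordinates relative to a lattice point: `Λ(y - Λ⁻¹β)_c = Λ(y)_c - β_c`. [folklore] -/
theorem coord_sub_latVec (β : Fin m → ℤ) (y : E) (c : Fin m) :
    (Λ (y - latVec Λ β)) c = (Λ y) c - β c := by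
  simp [map_sub]

/-- `P_β = 1` on the support of `η_β ψ`. [folklore] -/
theorem winAt_eq_one_of_mem_tsupport_eta (β : Fin m → ℤ) (ψ : 𝓢(E, ℂ)) {y : E}
    (hy : y ∈ tsupport (eta Λ β ψ : E → ℂ)) : winAt Λ β y = 1 := by
  rw [winAt_apply]
  refine winFun_eq_one Λ fun c => ?_
  rw [coord_sub_latVec]
  exact abs_le.2 (tsupport_eta_subset Λ β ψ hy c)

/-- `P_β` is supported in the period box `{|Λ(y)_c - β_c| ≤ 2}`. [folklore] -/
theorem tsupport_winAt_subset (β : Fin m → ℤ) :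
    tsupport (winAt Λ β : E → ℂ) ⊆ {y | ∀ c, |(Λ y) c - β c| ≤ 2} := by
  have hcl : IsClosed {y : E | ∀ c, |(Λ y) c - β c| ≤ 2} := by
    simp only [setOf_forall]
    refine isClosed_iInter fun c => isClosed_le ?_ continuous_const
    exact continuous_abs.comp (((EuclideanSpace.proj c).continuous.comp Λ.continuous).sub
      continuous_const)
  refine closure_minimal (fun y hy c => ?_) hcl
  rw [Function.mem_support, winAt_apply] at hy
  by_contra h
  push Not at h
  exact hy (winFun_eq_zero Λ ⟨c, by rw [coord_sub_latVec]; exact h.le⟩)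

/-- The elementary function `P₀ e_k` of the box at `0`, as a function. [folklore] -/
def charFun (k : Fin m → ℤ) : E → ℂ := fun y => winFun Λ y * eChar k (cubeCoord Λ y + cubeShift 0)

omit [FiniteDimensional ℝ E] in
/-- `P₀ e_k` is smooth. [folklore] -/
theorem contDiff_charFun (k : Fin m → ℤ) : ContDiff ℝ ∞ (charFun Λ k) :=
  (contDiff_winFun Λ).mul (contDiff_eChar_affine (cubeCoord Λ : E →L[ℝ] EuclideanSpace ℝ (Fin m))
    (cubeShift 0) k)

/-- `P₀ e_k` has compact support. [folklore] -/
theorem hasCompactSupport_charFun (k : Fin m → ℤ) : HasCompactSupport (charFun Λ k) :=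
  (hasCompactSupport_winFun Λ).mul_right

/-- The elementary function `P₀ e_k` as a complex test function. [folklore] -/
def char0 (k : Fin m → ℤ) : 𝓢(E, ℂ) := (hasCompactSupport_charFun Λ k).toSchwartzMap (contDiff_charFun Λ k)

/-- Evaluation of `char0`. [folklore] -/
@[simp]
theorem char0_apply (k : Fin m → ℤ) (y : E) :
    char0 Λ k y = winFun Λ y * eChar k (cubeCoord Λ y + cubeShift 0) := rfl

/-- **The elementary functions** `e_{β,k} = P_β e_k = (P₀ e_k)(· - Λ⁻¹β)` of the expansion. [folklore] -/
def e (β k : Fin m → ℤ) : 𝓢(E, ℂ) := SchwartzMap.compSubConstCLM ℂ (latVec Λ β) (char0 Λ k)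

/-- `e_{β,k}(y) = P_β(y) e_k(Λy/4 + w_β)`: the witness form required by
`tendsto_sum_boxCoeff_smul`. [folklore] -/
theorem e_apply (β k : Fin m → ℤ) (y : E) :
    e Λ β k y = winAt Λ β y * eChar k (cubeCoord Λ y + cubeShift β) := by
  rw [e, SchwartzMap.compSubConstCLM_apply, char0_apply, winAt_apply,
    cubeCoord_sub_latVec_add_cubeShift]

/-! ### The coefficient functionals -/

/-- Transport to the unit cube of the box at `β`, as a continuous linear map (`toCube` of
`SchwartzFourierDensity`). [folklore] -/
def toCubeCLM (β : Fin m → ℤ) : 𝓢(E, ℂ) →L[ℂ] 𝓢(EuclideanSpace ℝ (Fin m), ℂ) :=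
  (SchwartzMap.compSubConstCLM ℂ (cubeShift β)).comp
    (SchwartzMap.compCLMOfContinuousLinearEquiv ℂ (cubeCoord Λ).symm)

omit [FiniteDimensional ℝ E] in
/-- `toCubeCLM` is `toCube`. [folklore] -/
theorem toCubeCLM_apply (β : Fin m → ℤ) (ψ : 𝓢(E, ℂ)) :
    toCubeCLM Λ β ψ = toCube (cubeCoord Λ) (cubeShift β) ψ := rfl

/-- **The coefficient functionals** `ψ ↦ c_k(η_β ψ)`: the `k`-th box Fourier coefficient of the
localised piece `η_β ψ`, a continuous linear functional on `𝓢(E, ℂ)`. [folklore] -/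
def coeff (β k : Fin m → ℤ) : 𝓢(E, ℂ) →L[ℂ] ℂ :=
  (delta (intVec k)).comp ((SchwartzMap.fourierTransformCLM ℂ).comp ((toCubeCLM Λ β).comp (eta Λ β)))

omit [FiniteDimensional ℝ E] in
/-- `coeff Λ β k ψ = boxCoeff (Λ/4) w_β (η_β ψ) k`. [folklore] -/
theorem coeff_apply (β k : Fin m → ℤ) (ψ : 𝓢(E, ℂ)) :
    coeff Λ β k ψ = boxCoeff (cubeCoord Λ) (cubeShift β) (eta Λ β ψ) k := by
  simp only [coeff, ContinuousLinearMap.coe_comp, Function.comp_apply, delta_apply,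
    SchwartzMap.fourierTransformCLM_apply, boxCoeff, toCubeCLM_apply]
  rw [SchwartzMap.fourier_coe]

/-- **The Fourier expansion of the localised pieces**: for every `ψ ∈ 𝓢(E, ℂ)` and `β ∈ ℤᵐ`,
`η_β ψ = ∑_{k ∈ ℤᵐ} c_k(η_β ψ) · e_{β,k}` unconditionally in `𝓢(E, ℂ)` (the engine
`tendsto_sum_boxCoeff_smul` in the period box `{|Λ(y)_c - β_c| ≤ 2}` with the window `P_β`,
which is `1` on `supp η_β ⊆ {|Λ(y)_c - β_c| ≤ 1}`). [folklore] -/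
theorem hasSum_coeff_smul_e (β : Fin m → ℤ) (ψ : 𝓢(E, ℂ)) :
    HasSum (fun k : Fin m → ℤ => coeff Λ β k ψ • e Λ β k) (eta Λ β ψ) := by
  have hG : ∀ v ∈ tsupport (eta Λ β ψ : E → ℂ), ∀ c,
      (cubeCoord Λ v + cubeShift β) c ∈ Icc (1 / 4 : ℝ) (1 - 1 / 4) := by
    intro v hv c
    rw [cubeCoord_add_cubeShift_apply]
    have h := tsupport_eta_subset Λ β ψ hv c
    rw [mem_Icc] at h ⊢
    constructor <;> linarith [h.1, h.2]
  have hP1 : ∀ v ∈ tsupport (eta Λ β ψ : E → ℂ), winAt Λ β v = 1 := fun v hv =>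
    winAt_eq_one_of_mem_tsupport_eta Λ β ψ hv
  have hP0 : ∀ v ∈ tsupport (winAt Λ β : E → ℂ), ∀ c,
      (cubeCoord Λ v + cubeShift β) c ∈ Icc (0 : ℝ) 1 := by
    intro v hv c
    rw [cubeCoord_add_cubeShift_apply]
    have h := abs_le.1 (tsupport_winAt_subset Λ β hv c)
    rw [mem_Icc]
    constructor
    · apply div_nonneg _ (by norm_num); linarith [h.1]
    · rw [div_le_one (by norm_num : (0 : ℝ) < 4)]; linarith [h.2]
  have h := tendsto_sum_boxCoeff_smul (cubeCoord Λ) (cubeShift β) (by norm_num : (0 : ℝ) < 1 / 4)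
    (eta Λ β ψ) (winAt Λ β) hG hP1 hP0 (e Λ β) (e_apply Λ β)
  simp_rw [← coeff_apply] at h
  exact h

end Elementary

end NuclearExpansion

end Literature.MathematicalPhysics.QuantumLattice
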